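import Summits.BirchSwinnertonDyer.Rank1Residual.Additive.IstarZeroTwistGood
import Summits.BirchSwinnertonDyer.Rank1Residual.Additive.RamifiedTwistConductor
import Summits.BirchSwinnertonDyer.Rank1Residual.Additive.GordDescentThree
import Summits.BirchSwinnertonDyer.Rank1Residual.X11b.TamagawaQuadraticPlaces
import HarnessLib

/-!
# Additive classes X3/X4 at `p = 3`: the census cell (G-ord) IS Delbourgo's class (G) —
# `SubGord W 3 ↔ TypeG W 3`, and the `p = 3` class theorems in census currency

HONEST FRAMING (cell `b2b-bsdres`, run/shared/lean/b2b/bsd-rank1-residual/, verbatim in every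
file): the goal of the cell is to DELETE the COMBINATION-SHAPED residual classes of the
Birch–Swinnerton-Dyer formula for ALL analytic-rank `≤ 1` elliptic curves over `ℚ` — "full BSD
formula for every rank `≤ 1` curve in class `C`" assembled STRICTLY from published theorems — so
that the rank-`≤ 1` remainder becomes exactly the CONSTRUCTION-SHAPED classes, which are TYPED
(missing-input `Prop`s), NOT attempted. This is not "finishing BSD". Sub-cell `additive-p2`
(CLASS-OWNERS row "X3/X4 additive — pot. good ordinary / X3♯(G-ord)"), generation 8: research
route; no claim beyond the stated classes; theorems only, no definition, no named fact;
X3♯(G-ord)/X4♯(G-ord) stay CONSTRUCTION-SHAPED; labels / census / located gap UNCHANGED.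

WHAT THIS FILE DOES. The hyp seat's census cell **(G-ord)** of an additive prime is the DATA
predicate `SubGord W p = ¬(M) ∧ f_p(E) = 2 ∧ e ∣ p − 1` (`SharpenedStatements.lean`:
`ord_p j ≥ 0`, conductor exponent `2`, `e = 12/gcd(12, ord_p Δ_min)`); the sub-cell's THEORY class
is Delbourgo's (G) (`TypeG W p`: good reduction above `p` over a subfield of `ℚ(ζ_p)`). Gen 2
proved `SubGord W p → TypeG W p` for `p ≥ 5` (`typeG_of_subGord`, good reduction over `ℚ(ζ_p)` by
the `12 ∣ e·ord Δ` criterion of residue characteristic `≥ 5`) and `SubGord ↔ TypeG ∧ CondExpTwo`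
(`subGord_iff_typeG_and_condExpTwo`). At `p = 3` both directions were open (gen 7's NOTES: "needs
the conductor-exponent bit; not derivable without a conductor input"). They are theorems:

* **`typeG_three_of_subGord_of_addv`** — `SubGord W 3 → Addv W 3 → TypeG W 3`: the census bits
  force Kodaira type `I₀*` at `3` (Ogg's formula IS the tree's definition of the conductor
  exponent; `kodairaSymbolAt_eq_Istar_zero_of_conductorExponent_eq_two`), Tate's algorithm Step 6
  read backwards makes the twist `E^{(−3)}` GOOD at `3`
  (`hasGoodReductionAt_quadraticTwist_of_kodairaSymbolAt_eq_Istar_zero`, file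
  `IstarZeroTwistGood.lean`), and good reduction of `E^{(−3)}` at `3` is (G) over
  `ℚ(√−3) ⊆ ℚ(ζ₃)` (gen 0's `typeG_of_hasGoodReductionAtPrime_quadraticTwist`).
* **`condExpTwo_three_of_typeG_of_addv`**, **`subGord_three_of_typeG_of_addv`** — conversely (G)
  at an additive `3` gives `f₃(E) = 2` (a globally minimal model `V` of `E^{(−3)}` is good at `3` by
  gen 7's `TypeGThree.lean`; `E ≅ V^{(−3)}`; additive-p4's `condExpTwo_of_twist_pm_p`), `¬(M)`
  (gen 2) and `e = 2` (gen 7).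
* `subGord_three_iff_typeG`, `subGordTwo_three_iff_typeG`, `not_subGordHigher_three` (at `p = 3`
  the cell is entirely of defect `2`; `SubGordHigher` is empty on the additive locus — census: 421
  pairs, all `I₀*`), `classX3Gord_three_iff_subGord` (X3: the sub-class IS the census cell),
  `classX4Gord_three_iff_subGord` (X4: census cell + the ordinarity bit `3 ∤ a₃(E^{(−3)})`).
* The `p = 3` class theorems of `GordDescentThree.lean` restated on the census cell:
  `bsdp_three_of_classX3_of_subGord_of_forall_ramified`,
  `bsdp_three_of_classX4_of_subGord_of_surj_of_forall_ramified` — `BSD(E,3)` from the over-`K`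
  input over the quadratic fields ramified at `3`, and nothing else (binders displayed).

NET: the dictionary "census cell ⟺ theory class" of the sub-cell is kernel-complete at EVERY
prime `p ≥ 3` in BOTH directions. Labels UNCHANGED: the over-`K` input at a prime ramified in `K`
is reached by no published theorem (AUDIT-X34-GORD.md §3).

References: J. Tate, LNM 476 (1975) §7; J. H. Silverman, *ATAEC* IV.9.4, IV.10.4, IV.11.1, Table
4.1; D. Delbourgo, Compositio Math. 113 (1998) §1.5 (G); S. Comalada, J. Number Theory 49 (1994) §2.
-/

noncomputable section

open scoped Classical

open IsDedekindDomain IsDedekindDomain.HeightOneSpectrum NumberField Rat.HeightOneSpectrum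
  WeierstrassCurve Literature.NumberTheory.DiophantineGeometry
  Literature.NumberTheory.EllipticCurves Literature.NumberTheory.EllipticCurves.Rank1Residual
  Literature.NumberTheory.EllipticCurves.Rank1Residual.Typed
  Literature.NumberTheory.EllipticCurves.ModularForms
  Summit.BirchSwinnertonDyer.Rank1Residual.AdditivePotMult

namespace Summit.BirchSwinnertonDyer.Rank1Residual.Additive

/-! ### §3 `p = 3`: the census cell (G-ord) IS Delbourgo's (G) — `SubGord W 3 → TypeG W 3` -/

section Three

variable (W : WeierstrassCurve ℚ) [W.IsElliptic] [W.IsGloballyMinimal]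

/-- **The census cell implies (G) at `p = 3`.** For `E/ℚ` (globally minimal `W`) ADDITIVE at `3`
with the census bits `¬(M)` (`ord₃ j ≥ 0`), "tame" `f₃(E) = 2` and `e ∣ 3 − 1` (`SubGord W 3`,
`SharpenedStatements.lean`): `E` is of Delbourgo type (G) at `3` — indeed the twist `E^{(−3)}` is
GOOD at `3`. Route: the bits force Kodaira type `I₀*` at `3`
(`kodairaSymbolAt_eq_Istar_zero_of_conductorExponent_eq_two`; bridges
`conductorExponent_ringOfIntegers_eq`, `X11b.ordMinimalDiscriminant_eq_padicValInt`,
`semistabilityIndex_dvd_two_iff`), Tate's algorithm Step 6 read backwards makes `E^{(−3)}` good at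
`3` (`hasGoodReductionAt_quadraticTwist_of_kodairaSymbolAt_eq_Istar_zero`), and gen 0's
`typeG_of_hasGoodReductionAtPrime_quadraticTwist` (good reduction over `ℚ(√−3) ⊆ ℚ(ζ₃)`). The
`p = 3` twin of gen 2's `typeG_of_subGord` (`p ≥ 5`, cyclotomic route); with
`subGord_three_of_typeG_of_addv` below the dictionary "census cell (G-ord) = theory class (G)" is
an EQUIVALENCE at `p = 3` (census: 421 pairs, all `I₀*`). [cite: SilvermanATAEC1994, IV.9.4 Step 6 (PDF p. 345)] -/
theorem typeG_three_of_subGord_of_addv (hS : SubGord W 3) (hadd : Addv W 3) : TypeG W 3 := by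
  set u₃ : HeightOneSpectrum (𝓞 ℚ) := (primesEquiv (R := 𝓞 ℚ)).symm ⟨3, Nat.prime_three⟩
    with hu₃def
  have hu₃ : ((3 : ℕ) : 𝓞 ℚ) ∈ u₃.asIdeal :=
    (natCast_mem_asIdeal_iff_eq_primesEquiv_symm u₃ Nat.prime_three).mpr rfl
  have hv3 : (primesEquiv u₃ : ℕ) = 3 := by rw [hu₃def, Equiv.apply_symm_apply]
  have hv2 : (primesEquiv u₃ : ℕ) ≠ 2 := by rw [hv3]; decide
  obtain ⟨hnotM, hf2, he⟩ := hS
  -- additive at `u₃`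
  have hadd' : W.HasAdditiveReductionAt u₃ := hasAdditiveReductionAt_of_addv W 3 hadd
  -- `f₃ = 2` at the place of `𝓞 ℚ`
  have hf : W.conductorExponent u₃ = 2 := by
    have h : W.conductorExponent ((primesEquiv (R := ℤ)).symm ⟨3, Nat.prime_three⟩) = 2 := hf2
    rw [conductorExponent_ringOfIntegers_eq W u₃, ← h, hu₃def, Equiv.apply_symm_apply]
  -- `6 ∣ ord₃ Δ_min`
  have h6 : 6 ∣ W.ordMinimalDiscriminant u₃ := by
    rw [X11b.ordMinimalDiscriminant_eq_padicValInt W u₃ hv3]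
    exact (semistabilityIndex_dvd_two_iff W 3).mp (by simpa using he)
  -- `ord₃ j ≥ 0`
  have hj : u₃.valuation ℚ W.j ≤ 1 := by
    rw [valuation_le_one_iff_padicValuation_three u₃ hu₃]
    by_cases hj0 : W.j = 0
    · simp [hj0]
    rw [padicValuation_three_apply hj0, ← WithZero.exp_zero, WithZero.exp_le_exp]
    have : 0 ≤ padicValRat 3 W.j := not_lt.mp hnotM
    linarith
  -- `I₀*`, the twist is good, (G)
  have hK := kodairaSymbolAt_eq_Istar_zero_of_conductorExponent_eq_two u₃ W hv2 hadd' hf h6 hj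
  have hgood := hasGoodReductionAt_quadraticTwist_of_kodairaSymbolAt_eq_Istar_zero u₃ W hv2
    (D := -3) (by rw [hv3]; norm_num) (by rw [hv3]; decide) hK
  haveI := W.isElliptic_quadraticTwist (pStar_ne_zero 3)
  have hgood' : (W.quadraticTwist ((-1 : ℚ) ^ ((3 : ℕ) / 2) * (3 : ℕ))).HasGoodReductionAtPrime 3 := by
    have h3 : ((-1 : ℚ) ^ ((3 : ℕ) / 2) * (3 : ℕ)) = ((-3 : ℤ) : ℚ) := by rw [pStar_three]; norm_num
    rw [h3]
    haveI : (W.quadraticTwist (((-3 : ℤ) : ℚ))).IsElliptic := W.isElliptic_quadraticTwist (by norm_num)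
    exact hasGoodReductionAtPrime_of_hasGoodReductionAt _ u₃ hu₃ hgood
  exact typeG_of_hasGoodReductionAtPrime_quadraticTwist W 3 (by norm_num) hgood'

/-- **(G) implies "tame" at `p = 3`: `f₃(E) = 2`** for `E` additive at `3` of Delbourgo type (G).
A globally minimal model `V` of `E^{(−3)}` is GOOD at `3` (gen 7's Tate-algorithm theorem
`hasGoodReductionAtPrime_twist_three_of_typeG_of_addv`), `E ≅ V^{(−3)}` (twisting twice:
`quadraticTwist_smul`, `quadraticTwist_quadraticTwist`, `exists_variableChange_quadraticTwist_mul_sq`,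
`exists_variableChange_quadraticTwist_one`), and additive-p4's `condExpTwo_of_twist_pm_p` (the
ramified twist of a `3`-good curve has `f₃ = 2`: Kodaira `I₀*` + the tame case of Ogg's formula).
[cite: SilvermanATAEC1994, IV.10.4 and proof of IV.11.1 for p = 3 (PDF pp. 366–368)] -/
theorem condExpTwo_three_of_typeG_of_addv (hG : TypeG W 3) (hadd : Addv W 3) : CondExpTwo W 3 := by
  haveI : NeZero (2 : ℚ) := ⟨two_ne_zero⟩
  haveI := W.isElliptic_quadraticTwist (pStar_ne_zero 3)
  obtain ⟨C₁, hCmin⟩ :=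
    hasGlobalMinimalModel_rat_holds (W.quadraticTwist ((-1 : ℚ) ^ ((3 : ℕ) / 2) * (3 : ℕ)))
  haveI := hCmin
  set V := C₁ • W.quadraticTwist ((-1 : ℚ) ^ ((3 : ℕ) / 2) * (3 : ℕ)) with hVdef
  have hgoodV : V.HasGoodReductionAtPrime 3 :=
    hasGoodReductionAtPrime_twist_three_of_typeG_of_addv W hG hadd V ⟨C₁, rfl⟩
  -- `E ≅ V^{(−3)}`
  obtain ⟨C₀, hC₀⟩ := exists_variableChange_quadraticTwist_one W
  obtain ⟨C₉, hC₉⟩ := exists_variableChange_quadraticTwist_mul_sq W 1 3 three_ne_zero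
  set A : VariableChange ℚ := ⟨C₁.u, (-3) * C₁.r, 0, 0⟩ * (C₉ * C₀) with hAdef
  have hA : A • W = V.quadraticTwist (-3) := by
    rw [hAdef, mul_smul, mul_smul, hC₀, hC₉, hVdef, pStar_three,
      quadraticTwist_smul (W.quadraticTwist (-3)) two_ne_zero, quadraticTwist_quadraticTwist]
    norm_num
  have hW : A⁻¹ • V.quadraticTwist (-3) = W := by rw [← hA, inv_smul_smul]
  exact condExpTwo_of_twist_pm_p 3 (by norm_num) V (Or.inl hgoodV) (d := -3) (Or.inr (by norm_num))
    A⁻¹ hW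

/-- **(G) implies the census cell at `p = 3`**: `TypeG W 3 ∧ Addv W 3 → SubGord W 3` — `¬(M)` by
gen 2's `padicValRat_j_nonneg_of_typeG`, `f₃ = 2` by `condExpTwo_three_of_typeG_of_addv`, `e = 2`
by gen 7's `semistabilityIndex_eq_two_of_typeG_three`. -/
theorem subGord_three_of_typeG_of_addv (hG : TypeG W 3) (hadd : Addv W 3) : SubGord W 3 :=
  ⟨fun hm ↦ not_lt.mpr (padicValRat_j_nonneg_of_typeG W 3 hG) hm,
    condExpTwo_three_of_typeG_of_addv W hG hadd,
    by rw [semistabilityIndex_eq_two_of_typeG_three W hG hadd]⟩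

/-- **THE DICTIONARY AT `p = 3`: census cell (G-ord) = Delbourgo's class (G)** on the additive
locus: `SubGord W 3 ↔ TypeG W 3`. The `p = 3` twin of gen 2's `subGord_iff_typeG_and_condExpTwo`
(`p ≥ 5`) — at `p = 3` WITHOUT the conductor bit on the right (it is a theorem,
`condExpTwo_three_of_typeG_of_addv`). -/
theorem subGord_three_iff_typeG (hadd : Addv W 3) : SubGord W 3 ↔ TypeG W 3 :=
  ⟨fun hS ↦ typeG_three_of_subGord_of_addv W hS hadd, fun hG ↦ subGord_three_of_typeG_of_addv W hG hadd⟩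

/-- At `p = 3` the cell (G-ord) is entirely of defect `2` (`I₀*`): `SubGordTwo W 3 ↔ TypeG W 3`. -/
theorem subGordTwo_three_iff_typeG (hadd : Addv W 3) : SubGordTwo W 3 ↔ TypeG W 3 :=
  ⟨fun hS ↦ typeG_three_of_subGord_of_addv W hS.1 hadd, fun hG ↦
    ⟨subGord_three_of_typeG_of_addv W hG hadd, semistabilityIndex_eq_two_of_typeG_three W hG hadd⟩⟩

/-- At `p = 3` the sub-cell `SubGordHigher` (`e ∈ {3, 4, 6}`) is EMPTY on the additive locus
(census: 0 pairs). -/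
theorem not_subGordHigher_three (hadd : Addv W 3) : ¬ SubGordHigher W 3 := fun h ↦
  h.2 (semistabilityIndex_eq_two_of_typeG_three W (typeG_three_of_subGord_of_addv W h.1 hadd) hadd)

/-- **X3 at `p = 3`: the sub-class X3♯(G-ord) is exactly the census cell** —
`ClassX3Gord W 3 ↔ SubGord W 3` on X3 (ordinarity automatic for X3, gen 7's
`classX3Gord_three_iff_typeG`). -/
theorem classX3Gord_three_iff_subGord (hX : ClassX3 W 3) : ClassX3Gord W 3 ↔ SubGord W 3 := by
  rw [classX3Gord_three_iff_typeG W hX, subGord_three_iff_typeG W hX.2]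

/-- **X4 at `p = 3`: (G)-ordinary = census cell + the ordinarity bit of the twist.** For any globally
minimal model `Wd` of `E^{(−3)}`: `ClassX4Gord W 3 ↔ SubGord W 3 ∧ 3 ∤ a₃(Wd)` on X4 (gen 7's
`typeGOrd_three_iff_goodOrd_twist`, `typeG_three_iff_good_twist`). -/
theorem classX4Gord_three_iff_subGord (hX : ClassX4 W 3) (Wd : WeierstrassCurve ℚ) [Wd.IsElliptic]
    [Wd.IsGloballyMinimal] (C : VariableChange ℚ)
    (hWd : C • W.quadraticTwist ((-1 : ℚ) ^ ((3 : ℕ) / 2) * (3 : ℕ)) = Wd) :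
    ClassX4Gord W 3 ↔ SubGord W 3 ∧ ¬ (3 : ℤ) ∣ Wd.frobeniusTrace 3 := by
  have hadd : Addv W 3 := hX.2.1
  constructor
  · intro h
    have hord := (typeGOrd_three_iff_goodOrd_twist W hadd Wd C hWd).mp h.2
    exact ⟨subGord_three_of_typeG_of_addv W h.2.typeG hadd, hord.2⟩
  · rintro ⟨hS, ha⟩
    have hG := typeG_three_of_subGord_of_addv W hS hadd
    exact ⟨hX, (typeGOrd_three_iff_goodOrd_twist W hadd Wd C hWd).mpr
      ⟨(typeG_three_iff_good_twist W hadd Wd C hWd).mp hG, ha⟩⟩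

/-- **X3♯(G-ord) at `p = 3` in CENSUS currency, `r_an(E) ≤ 1`: `BSD(E,3)` from the over-`K` input
over the quadratic fields ramified at `3` — and nothing else** (gen 7's
`bsdp_three_of_classX3_of_typeG_of_forall_ramified` on the census cell `SubGord W 3`; binders as
there: Castella–Grossi–Skinner Thm. D chain, Greenberg–Vatsal, Greenberg, modularity, GZK, Milne,
Hoffstein–Luo). Labels UNCHANGED: the over-`K` input at the ramified prime is in print nowhere.
[cite: HoffsteinLuo1997, Theorem (§1, pp. 435–436)] [cite: CastellaGrossiSkinner2025, Thm. D (= 'Thm. 4')] -/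
theorem bsdp_three_of_classX3_of_subGord_of_forall_ramified
    (hCGS : CastellaGrossiSkinner2025.thmD_padicValRat_bsd_rank_le_one)
    (hGV : GreenbergVatsal2000.thm13_charIdeal_eq_of_gvPar) (hGr : greenberg_charValue_rankZero)
    (hmod : hasEntireLFunction_rat) (hmodP : nonempty_modularParametrizationData)
    (hGZK : rank_eq_analyticRank_of_analyticRank_le_one)
    (hMilneC : Milne1972.bsdQuotient_baseChange_quadratic_anyModel)
    (hHL : HoffsteinLuo1997_exists_twist_L_one_ne_zero)
    (hX : ClassX3 W 3) (hS : SubGord W 3) (hr : W.analyticRank ≤ 1)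
    (hK : ∀ (K : Type) [Field K] [NumberField K], Module.finrank ℚ K = 2 →
      (3 : ℤ) ∣ NumberField.discr K → MissingPPartOverCAt (W.baseChange K) 3) :
    BSDp W 3 :=
  bsdp_three_of_classX3_of_typeG_of_forall_ramified W hCGS hGV hGr hmod hmodP hGZK hMilneC hHL hX
    (typeG_three_of_subGord_of_addv W hS hX.2) hr hK

/-- **X4♯(G-ord) at `p = 3` in CENSUS currency, `ρ̄_{E,3}` onto, `r_an(E) ≤ 1`: `BSD(E,3)` from the
over-`K` input over the quadratic fields ramified at `3` — and nothing else** (gen 7's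
`bsdp_three_of_classX4Gord_of_surj_of_forall_ramified'` on the census cell `SubGord W 3` plus the
ordinarity bit `3 ∤ a₃(Wd)` of a globally minimal model `Wd` of `E^{(−3)}`; binders: row C16 —
Yan–Zhu Thm. 4.15, Wuthrich Lemma 20 —, modularity, GZK, Milne, Hoffstein–Luo). Labels UNCHANGED.
[cite: HoffsteinLuo1997, Theorem (§1, pp. 435–436)] [cite: YanZhu2026, Thm. 4.15] -/
theorem bsdp_three_of_classX4_of_subGord_of_surj_of_forall_ramified
    (hYZ : YanZhu2026.thm415_padicValRat_bsd_rank_le_one)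
    (hW20 : Wuthrich2014.lemma20_surjective_threeAdic_of_semistable)
    (hmod : hasEntireLFunction_rat) (hGZK : rank_eq_analyticRank_of_analyticRank_le_one)
    (hMilneC : Milne1972.bsdQuotient_baseChange_quadratic_anyModel)
    (hHL : HoffsteinLuo1997_exists_twist_L_one_ne_zero)
    (hX : ClassX4 W 3) (hS : SubGord W 3) (Wd : WeierstrassCurve ℚ) [Wd.IsElliptic]
    [Wd.IsGloballyMinimal] (C : VariableChange ℚ)
    (hWd : C • W.quadraticTwist ((-1 : ℚ) ^ ((3 : ℕ) / 2) * (3 : ℕ)) = Wd)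
    (hord : ¬ (3 : ℤ) ∣ Wd.frobeniusTrace 3) (hsurj : Surj W 3) (hr : W.analyticRank ≤ 1)
    (hK : ∀ (K : Type) [Field K] [NumberField K], Module.finrank ℚ K = 2 →
      (3 : ℤ) ∣ NumberField.discr K → MissingPPartOverCAt (W.baseChange K) 3) :
    BSDp W 3 :=
  bsdp_three_of_classX4Gord_of_surj_of_forall_ramified' W hYZ hW20 hmod hGZK hMilneC hHL
    ((classX4Gord_three_iff_subGord W hX Wd C hWd).mpr ⟨hS, hord⟩) hsurj hr hK

end Three

end Summit.BirchSwinnertonDyer.Rank1Residual.Additive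

end
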